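import Literature.IUT.HodgeArakelov.CohomologyAutFunctoriality

/-!
# The action of an automorphism pair on `lim_K H¹(H|_K, A)` is an AUTOMORPHISM (inverse pair)

Follow-up to `CohomologyAutFunctoriality.lean` (F14-a / GAP row G-w4d010-2 (a)): for a compatible automorphism
pair `(α, β)` whose companion `β` maps `A` ONTO `A` (so that `(α⁻¹, β⁻¹)` is again a compatible pair), the limit
action `h1LimAut` is an additive AUTOMORPHISM `h1LimAutEquiv : lim ≃+ lim` with inverse the action of
`(α⁻¹, β⁻¹)` — the shape of the interface datum `ThetaEvaluation.iotaLim : lim ≃+ lim` of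
`ConstantMultipleRigidity.lean` ([IUTchII] Cor. 1.12 (i), kurims p. 57: "`ι` induces an 'action up to torsion'")
at the model. Construction over the landed files; nothing of [IUTchII] is asserted (claim key `Mochizuki2012`,
disputed).
-/

namespace Literature.IUT.HodgeArakelov

open Literature.AnabelianGeometry.EtaleTheta CohomologySystemOfContH1

universe u

noncomputable section

namespace ContH1Aut

/-- The inverse pair is compatible: `β⁻¹ ∘ φ = φ ∘ α⁻¹`. [cite: NeukirchSchmidtWingberg2008, I §5] -/
theorem compat_symm {G : Type u} {G' : Type u} [Group G] [TopologicalSpace G] [Group G'] [TopologicalSpace G']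
    (φ : G →* G') (α : G ≃ₜ* G) (β : G' ≃ₜ* G') (hφ : ∀ g, β (φ g) = φ (α g)) (g : G) :
    β.symm (φ g) = φ (α.symm g) := by
  apply β.injective
  rw [ContinuousMulEquiv.apply_symm_apply, hφ, ContinuousMulEquiv.apply_symm_apply]

/-- If `β(A) = A` then `β⁻¹(A) ⊆ A`. [cite: NeukirchSchmidtWingberg2008, I §5] -/
theorem mem_symm {G' : Type u} [Group G'] [TopologicalSpace G'] (A : Subgroup G') (β : G' ≃ₜ* G')
    (hA : ∀ a : G', a ∈ A ↔ β a ∈ A) (a : G') (ha : a ∈ A) : β.symm a ∈ A := by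
  rw [hA, ContinuousMulEquiv.apply_symm_apply]; exact ha

variable {G : Type u} {G' : Type u} [Group G] [TopologicalSpace G]
  [Group G'] [TopologicalSpace G'] [IsTopologicalGroup G']
  (φ : G →* G') (A : Subgroup G') [A.Normal] [IsMulCommutative A]

/-- Transporting along `(α, β)` (`H → H'`) and then along `(α⁻¹, β⁻¹)` (`H' → H''`, `H'' ⊆ H`) is the
RESTRICTION `H¹(H, A) → H¹(H'', A)`. [cite: NeukirchSchmidtWingberg2008, I §5] -/
theorem autMap_symm_autMap (α : G ≃ₜ* G) (β : G' ≃ₜ* G') (hφ : ∀ g, β (φ g) = φ (α g))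
    (hA : ∀ a : G', a ∈ A ↔ β a ∈ A) {H H' H'' : Subgroup G} (hH : ∀ x, x ∈ H' → α.symm x ∈ H)
    (hH' : ∀ x, x ∈ H'' → α.symm.symm x ∈ H') (hle : H'' ≤ H) (x : ContH1 φ A H) :
    autMap φ A α.symm β.symm (compat_symm φ α β hφ) (mem_symm A β hA) hH'
      (autMap φ A α β hφ (fun a ha => (hA a).mp ha) hH x) = ContH1.res φ A hle x := by
  induction x using QuotientGroup.induction_on with
  | H f =>
    rw [autMap_mk, autMap_mk]
    change _ = QuotientGroup.mk (ContH1.resCocycle φ A hle f)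
    congr 1
    apply Subtype.ext; funext y; apply Subtype.ext
    rw [coe_autCocycle_apply, coe_autCocycle_apply, ContinuousMulEquiv.symm_apply_apply]
    have hy : (⟨α.symm (α.symm.symm (y : G)), hH _ (hH' y y.2)⟩ : H) = ⟨(y : G), hle y.2⟩ :=
      Subtype.ext (α.symm_apply_apply (y : G))
    rw [hy]
    rfl

end ContH1Aut

section Limit

variable {P : TopGroup.{u}} {G' : Type u} [Group G'] [TopologicalSpace G'] [IsTopologicalGroup G']
  (φ : P →* G') (A : Subgroup G') [A.Normal] [IsMulCommutative A] (H : Subgroup P)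
  (α : P ≃ₜ* P) (β : G' ≃ₜ* G') (hφ : ∀ g, β (φ g) = φ (α g)) (hA : ∀ a : G', a ∈ A ↔ β a ∈ A)
  (hH : ∀ x, x ∈ H ↔ α x ∈ H)

omit [IsTopologicalGroup G'] [A.Normal] [IsMulCommutative A] in
/-- `α⁻¹` stabilises `H` if `α` does. [cite: Mochizuki2012, Prop 1.4 p.27] -/
theorem stab_symm (hH : ∀ x, x ∈ H ↔ α x ∈ H) (x : P) : x ∈ H ↔ α.symm x ∈ H := by
  rw [hH (α.symm x), ContinuousMulEquiv.apply_symm_apply]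

/-- `α⁻¹(α K) = K`. [cite: Mochizuki2012, Prop 1.4 p.27] -/
theorem Idx.K_mapAut_symm_mapAut (i : Idx (P := P) ⊥) :
    (Idx.mapAut α.symm (Idx.mapAut α i)).K = i.K := by
  rw [Idx.K_mapAut, Idx.K_mapAut, Subgroup.map_map]
  have hcomp : α.symm.toMulEquiv.toMonoidHom.comp α.toMulEquiv.toMonoidHom = MonoidHom.id P :=
    MonoidHom.ext fun x => α.symm_apply_apply x
  rw [hcomp, Subgroup.map_id]

/-- `h1LimAut` for `(α⁻¹, β⁻¹)` undoes `h1LimAut` for `(α, β)`. [cite: Mochizuki2012, Cor 1.12 (i) p.57] -/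
theorem h1LimAut_symm_h1LimAut (z : h1Lim φ A H ⊥) :
    h1LimAut φ A H α.symm β.symm (ContH1Aut.compat_symm φ α β hφ) (ContH1Aut.mem_symm A β hA)
        (stab_symm H α hH) (h1LimAut φ A H α β hφ (fun a ha => (hA a).mp ha) hH z) = z := by
  have key : ((h1LimAut φ A H α.symm β.symm (ContH1Aut.compat_symm φ α β hφ) (ContH1Aut.mem_symm A β hA)
        (stab_symm H α hH)).comp (h1LimAut φ A H α β hφ (fun a ha => (hA a).mp ha) hH)) =
      AddMonoidHom.id _ := by
    refine h1Lim_hom_ext φ A H fun i y => ?_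
    rw [AddMonoidHom.comp_apply, h1LimAut_of, h1LimAut_of, AddMonoidHom.id_apply]
    -- the index `α⁻¹(α K) = K`: compare through `of_f` along `K ≤ α⁻¹ α K` (an equality of subgroups)
    have hle : i ≤ Idx.mapAut α.symm (Idx.mapAut α i) := by
      change (Idx.mapAut α.symm (Idx.mapAut α i)).K ≤ i.K
      rw [Idx.K_mapAut_symm_mapAut]
    rw [← h1Of_fmod φ A H ⊥ hle y]
    congr 1
    exact congrArg Additive.ofMul (ContH1Aut.autMap_symm_autMap φ A α β hφ hA
      (symm_mem_inf H α hH i.K) (symm_mem_inf H α.symm (stab_symm H α hH) (Idx.mapAut α i).K)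
      (inf_le_inf_left H (Idx.le_iff.mp hle)) (Additive.toMul y))
  exact DFunLike.congr_fun key z

/-- `α.symm.symm = α` bookkeeping for the stabiliser hypothesis. [cite: Mochizuki2012, Prop 1.4 p.27] -/
theorem stab_symm_symm (x : P) : (x ∈ H ↔ α.symm.symm x ∈ H) ↔ (x ∈ H ↔ α x ∈ H) := Iff.rfl

/-- **The action of `(α, β)` on `lim_K H¹(H|_K, A)` as an additive AUTOMORPHISM**, inverse = the action of
`(α⁻¹, β⁻¹)` (for `β(A) = A` and `α` stabilising `H`): the model shape of `ThetaEvaluation.iotaLim : lim ≃+ lim`.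
[cite: Mochizuki2012, Cor 1.12 (i) p.57] -/
def h1LimAutEquiv : h1Lim φ A H ⊥ ≃+ h1Lim φ A H ⊥ where
  toFun := h1LimAut φ A H α β hφ (fun a ha => (hA a).mp ha) hH
  invFun := h1LimAut φ A H α.symm β.symm (ContH1Aut.compat_symm φ α β hφ) (ContH1Aut.mem_symm A β hA)
    (stab_symm H α hH)
  left_inv z := h1LimAut_symm_h1LimAut φ A H α β hφ hA hH z
  right_inv z := by
    -- apply the previous lemma to the pair `(α⁻¹, β⁻¹)`, whose inverse pair is `(α, β)`
    have h := h1LimAut_symm_h1LimAut φ A H α.symm β.symm (ContH1Aut.compat_symm φ α β hφ)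
      (fun a => by rw [(hA (β.symm a)), ContinuousMulEquiv.apply_symm_apply]) (stab_symm H α hH) z
    exact h
  map_add' := map_add _

/-- `h1LimAutEquiv` is `h1LimAut` as a function. [cite: Mochizuki2012, Cor 1.12 (i) p.57] -/
@[simp] theorem h1LimAutEquiv_apply (z : h1Lim φ A H ⊥) :
    h1LimAutEquiv φ A H α β hφ hA hH z = h1LimAut φ A H α β hφ (fun a ha => (hA a).mp ha) hH z := rfl

end Limit

end

end Literature.IUT.HodgeArakelov
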